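import Literature.AlgebraicGeometry.HodgeTheory.HodgeTypePullbackVanishing
import Literature.AlgebraicGeometry.HodgeTheory.HodgeTypeConjugation
import Literature.AlgebraicGeometry.HodgeTheory.ComplexConjugationHolds
import Literature.AlgebraicGeometry.HodgeTheory.SupportedHodgeClassDescent
import Literature.AlgebraicGeometry.HodgeTheory.GysinKernelSplitHolds
import Literature.AlgebraicGeometry.HodgeTheory.GysinFormalismPushforward

/-!
# Stub 2 of the birth skeleton of `SupportedBridgeClassesVanish` (item 3276), PROVED:
# extreme Hodge types die under non-dominant pull-back

`stub_pullbackVanishOfNotDominant_proof`: for `X` smooth projective of dimension `n`, a proper closed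
`X' ⊊ X`, a morphism `r : T ⟶ X` from a smooth projective `T` with `r(T) ⊆ X'`, and a class
`b ∈ Hⁿ(X(ℂ); ℂ)` of Hodge type `(n,0)` or `(0,n)`: `r^* b = 0`. Proof (Deligne, Hodge III 8.2.5/8.2.7
in the tree's form): resolve the components of `X'` by smooth projective `Y_j → X` of dimensions
`< n` (`exists_family_iUnion_range_eq` with Hironaka); a class of type `(n,0)` dies on each `Y_j`
(`IsOfHodgeType.map_eq_zero_of_lt_left`), hence (Prop. 8.2.7, the tree's theorem
`Deligne1974_ker_pullback_eq_ker_pullback_resolution_holds`) on an open neighbourhood `V ⊇ X'(ℂ)` in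
`X(ℂ)`, through which `r(ℂ)` factors; type `(0,n)` is the conjugate of type `(n,0)` and conjugation is
natural. Together with `GysinSpan.lean` (stub 1) and the composition in
`BirthSupportedBridgeClassesVanish.lean`, item 3276 (no-go lemma (A)) is COMPLETELY PROVED modulo
assembling the three files (prover: one Theorems file, `--workitem stmt-HodgeConjecture-3276`).
-/

open CategoryTheory AlgebraicGeometry
open Literature.AlgebraicGeometry Literature.AlgebraicGeometry.HodgeTheory
open Literature.AlgebraicTopology.SingularHomology

namespace Summit.HodgeConjecture.HodgeConjecture.Cruxes.ExtremeBridgeFailure.SupportedVanish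

/-- Type `(n,0)` case. -/
theorem map_eq_zero_of_range_subset_of_type_n0 {n d : ℕ} {X T : Motives.SchemeOver ℂ}
    (hX : Motives.IsSmoothProjective n X) {X' : Set X.left} (hX'c : IsClosed X')
    (hX'u : X' ≠ Set.univ) (hT : Motives.IsSmoothProjective d T) (r : T ⟶ X)
    (hr : Set.range r.left.base ⊆ X') {c : complexBetti X n} (hc : IsOfHodgeType n X n n 0 c) :
    complexBetti.map r n c = 0 := by
  -- resolutions of the components of `X'`
  have hZ1 : ∀ z ∈ X', (1 : ℕ∞) ≤ Order.coheight z := fun z hz ↦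
    one_le_coheight_of_mem_of_isClosed hX hX'c hX'u hz
  obtain ⟨ι, _, m, Y, hY, g, hm, hU⟩ :=
    exists_family_iUnion_range_eq Resolution.Hironaka1964_projective_holds hX hX'c hZ1
  -- `c` dies on each `Y j` (type `(n,0)`, `dim Y j < n`)
  have hg0 : ∀ j, complexBetti.map (g j) n c = 0 := fun j ↦ by
    obtain ⟨B⟩ := nonempty_hodgeModel_holds (n := m j) (X := Y j) (hY j)
    exact hc.map_eq_zero_of_lt_left (hY j) hX B (g j) (hm j)
  -- Deligne: `c` dies on an open `V ⊇ X'(ℂ)`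
  obtain ⟨V, -, hsub, hV⟩ :=
    Deligne1974_ker_pullback_eq_ker_pullback_resolution_holds hX hY g n c hg0
  -- `r(ℂ)` lands in `V`
  have hland : ∀ P : Motives.ComplexPoints T, Motives.AlgPoints.mapContinuous (L := ℂ) r P ∈ V := by
    intro P
    apply hsub
    show (Motives.AlgPoints.map r P).pt ∈ ⋃ j, Set.range (g j).left.base
    rw [hU, Motives.AlgPoints.pt_map]
    exact hr ⟨P.pt, rfl⟩
  let r' : C(Motives.ComplexPoints T, V) :=
    ⟨fun P ↦ ⟨_, hland P⟩, (Motives.AlgPoints.mapContinuous (L := ℂ) r).continuous.subtype_mk _⟩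
  have hfac : Motives.AlgPoints.mapContinuous (L := ℂ) r = (subsetIncl V).comp r' := rfl
  change singularCohomology.map ℂ ℂ (Motives.AlgPoints.mapContinuous (L := ℂ) r) n c = 0
  rw [hfac, singularCohomology.map_comp, ModuleCat.comp_apply, hV, map_zero]

/-- **Stub 2 of the skeleton of item 3276, proved** (both extreme types). -/
theorem stub_pullbackVanishOfNotDominant_proof :
    ∀ (n : ℕ) (X : Motives.SchemeOver ℂ) (_ : Motives.IsSmoothProjective n X) (X' : Set X.left),
      IsClosed X' → X' ≠ Set.univ →
      ∀ (d : ℕ) (T : Motives.SchemeOver ℂ) (_ : Motives.IsSmoothProjective d T) (r : T ⟶ X),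
        Set.range r.left.base ⊆ X' →
        ∀ b : complexBetti X n, (IsOfHodgeType n X n n 0 b ∨ IsOfHodgeType n X n 0 n b) →
          complexBetti.map r n b = 0 := by
  intro n X hX X' hX'c hX'u d T hT r hr b hb
  rcases hb with hb | hb
  · exact map_eq_zero_of_range_subset_of_type_n0 hX hX'c hX'u hT r hr hb
  · obtain ⟨c, hc, rfl⟩ := hb.exists_eq_conjClass hX
    change singularCohomology.map ℂ ℂ (Motives.AlgPoints.mapContinuous (L := ℂ) r) n
      (HodgeTheory.conjClass (Motives.ComplexPoints X) n c) = 0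
    rw [← conjClass_map]
    have h0 := map_eq_zero_of_range_subset_of_type_n0 hX hX'c hX'u hT r hr hc
    change singularCohomology.map ℂ ℂ (Motives.AlgPoints.mapContinuous (L := ℂ) r) n c = 0 at h0
    rw [h0, conjClass_zero]

end Summit.HodgeConjecture.HodgeConjecture.Cruxes.ExtremeBridgeFailure.SupportedVanish
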